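import Mathlib
import Summits.NavierStokesRegularity.NavierStokesRegularity.Theorems.EulerZoomLiouvillePowerGaugeEulerLiouvilleHelicityTubeStarvation
import HarnessLib

/-!
# Crux `EulerZoomLiouville.PowerGaugeEulerLiouville` (stmt-NavierStokesRegularity-19832), line `helicity-tube` rev4, stub T2′:
# THE ZERO-HELICITY LAW — GRADIENT-FREE (the landed T2 proof with its dead gradient-clause binder removed)

Route №10 `EulerZoomLiouville` (NavierStokesRegularity), crux E.  Line `helicity-tube` (ideator ns-idea-11 g4;
`Cruxes/PowerGaugeEulerLiouville/Lines/helicity_tube.lean` rev4 985d9ffb2a69), stub **T2 `stub_helicityStarvation` in its GRADIENT-FREE text**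
(`IsDriftingPastWith` WITHOUT the clause «`∇u` bounded on compact time sets, uniformly in `x`»).  The rev1 text WITH the clause is LANDED:
`HelicityTube.weightedHelicity_eq_zero_of_tubesPersist` (ns-ezl-w5 g0, p627972) — and, as the line owner recorded (rev4 docstring of
`stub_helicityStarvation`: «that proof never uses the gradient clause (its binder is the discarded `_hgrad`), so the upgrade is the same file with one
binder deleted»), its proof never touches the clause.  This file is exactly that: the statement with the clause conjunct deleted and the proof of
p627972 VERBATIM (credit: ns-ezl-w5 g0; the helpers `sq_integral_le_lintegral_mul_lintegral`, `window_le_rpow_min`, `exponent_race` are IMPORTED from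
that file, not restated).

THE ARGUMENT (unchanged; see p627972's docstring): if some tube datum has helicity `h ≠ 0`, its persistent avatars give the slice floor
`∫_{B(a)}|curl u(s)|² ≥ h²/((c+1) a^{1−2ρ})` on the usable window (Cauchy–Schwarz against the `A`-gauge), whose time integral beats the windowed
`E`-budget `16 c a^{1−ρ}` (`CasimirFloor.lintegral_window_sq_curl_le`) by the exponent race `min(2, 1/(1−κ)) > 2 − 3ρ ⇔ κ > (1−3ρ)/(2−3ρ)`.

* `weightedHelicity_eq_zero_of_tubesPersist_free` — **T2′ = `Sig.stub_helicityStarvation` (rev4, gradient-free) with `InClass`, `IsDriftingPastWith`,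
  `helicityDriftThreshold`, `TubesPersist`, `IsTubeWeight`, `weightedHelicity`, `driftRadius` UNFOLDED VERBATIM.**

WHAT THIS IS NOT: not NS, not the crux — a helper `--supports` stmt-19832; with T1′ (`…HelicityTubeTubeTransportFree`) it makes the GRADIENT-FREE
stratum `IsHelicalTubePast` empty by the line's own composition; the residue T3 `stub_helicityRest`, crux 19832 and NS regularity stay OPEN.
[cite: MajdaBertozziCUP2002, §1.6 Prop. 1.12; CaffarelliKohnNirenberg1982, §2]
-/

-- adapted from Theorems/EulerZoomLiouvillePowerGaugeEulerLiouvilleHelicityTubeStarvation.lean (ns-ezl-w5 g0, p627972): proof verbatim,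
-- one dead binder removed from the statement.

noncomputable section

-- flat `Theorems/<Route><Decl>…` files of one crux share the namespace of the crux (tree convention)
set_option linter.dupNamespace false

open MeasureTheory Set Filter Topology Metric Function Real InnerProductSpace
open scoped NNReal ENNReal RealInnerProductSpace ContDiff

namespace Summit.NavierStokesRegularity.NavierStokesRegularity.Theorems.PowerGaugeEulerLiouville.HelicityTube

open Literature.Analysis Literature.Analysis.FluidPDE
open Summit.NavierStokesRegularity.NavierStokesRegularity.Theorems.PowerGaugeEulerLiouville.CasimirFloor

/-- **T2′ `stub_helicityStarvation` of the line `helicity-tube`, GRADIENT-FREE, signature unfolded — THE ZERO-HELICITY LAW** (rev4 defs; NO gradient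
clause): for a member of the power-gauged class (`0 < ρ ≤ 1/2`) with a drifting classical far past `(T₁, M, κ)` of exponent `κ > (1−3ρ)/(2−3ρ)` on which
tube data persist backward with their helicity, EVERY tube datum at every time `τ < T₁` has zero weighted helicity.  (Proof = p627972's, ns-ezl-w5 g0,
verbatim.) [cite: MajdaBertozziCUP2002, §1.6 Prop. 1.12; CaffarelliKohnNirenberg1982, §2] -/
theorem weightedHelicity_eq_zero_of_tubesPersist_free :
    ∀ ρ : ℝ, 0 < ρ → ρ ≤ 1 / 2 →
      ∀ (u : ℝ → EuclideanSpace ℝ (Fin 3) → EuclideanSpace ℝ (Fin 3)) (p : ℝ → EuclideanSpace ℝ (Fin 3) → ℝ)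
        (H : ℝ → EuclideanSpace ℝ (Fin 3) → EuclideanSpace ℝ (Fin 3) →L[ℝ] EuclideanSpace ℝ (Fin 3)) (c : ℝ≥0),
        (IsSuitableWeakSolutionOn (slab (EuclideanSpace ℝ (Fin 3)) (Set.Iio 0) isOpen_Iio) 0 0 u p ∧
            HasWeakSpatialGradientOn (slab (EuclideanSpace ℝ (Fin 3)) (Set.Iio 0) isOpen_Iio) u H ∧
            (∀ a : ℝ, 0 < a →
              ENNReal.ofReal (a ^ (2 * ρ)) * cknA a (0 : ℝ × EuclideanSpace ℝ (Fin 3)) u +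
                    ENNReal.ofReal (a ^ ρ) * cknE a (0 : ℝ × EuclideanSpace ℝ (Fin 3)) H +
                  ENNReal.ofReal (a ^ (2 * ρ)) * cknD a (0 : ℝ × EuclideanSpace ℝ (Fin 3)) p ≤ (c : ℝ≥0∞))) →
          ∀ (T₁ M κ : ℝ),
            (IsClassicalEulerSolutionOn (Set.Iio 0) 0 u p ∧ T₁ ≤ 0 ∧ 0 ≤ M ∧ κ < 1 ∧
                (∀ τ : ℝ, τ < T₁ → ∀ x : EuclideanSpace ℝ (Fin 3), ‖u τ x‖ ≤ M * (-τ) ^ (-κ))) →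
              (1 - 3 * ρ) / (2 - 3 * ρ) < κ →
                (∀ τ : ℝ, τ < T₁ → ∀ (χ : EuclideanSpace ℝ (Fin 3) → ℝ) (R : ℝ), 0 < R →
                    (ContDiff ℝ ∞ χ ∧ (∀ x : EuclideanSpace ℝ (Fin 3), |χ x| ≤ 1) ∧
                        (∀ x : EuclideanSpace ℝ (Fin 3), R ≤ ‖x‖ → χ x = 0) ∧
                        ∀ x : EuclideanSpace ℝ (Fin 3), fderiv ℝ χ x (curl (u τ) x) = 0) →
                      ∀ s : ℝ, s < τ →
                        ∃ χ' : EuclideanSpace ℝ (Fin 3) → ℝ,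
                          (ContDiff ℝ ∞ χ' ∧ (∀ x : EuclideanSpace ℝ (Fin 3), |χ' x| ≤ 1) ∧
                              (∀ x : EuclideanSpace ℝ (Fin 3),
                                R + M / (1 - κ) * ((-s) ^ (1 - κ) - (-τ) ^ (1 - κ)) ≤ ‖x‖ → χ' x = 0) ∧
                              ∀ x : EuclideanSpace ℝ (Fin 3), fderiv ℝ χ' x (curl (u s) x) = 0) ∧
                            ∫ x, χ' x * ⟪u s x, curl (u s) x⟫ = ∫ x, χ x * ⟪u τ x, curl (u τ) x⟫) →
                  ∀ τ : ℝ, τ < T₁ → ∀ (χ : EuclideanSpace ℝ (Fin 3) → ℝ) (R : ℝ), 0 < R →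
                    (ContDiff ℝ ∞ χ ∧ (∀ x : EuclideanSpace ℝ (Fin 3), |χ x| ≤ 1) ∧
                        (∀ x : EuclideanSpace ℝ (Fin 3), R ≤ ‖x‖ → χ x = 0) ∧
                        ∀ x : EuclideanSpace ℝ (Fin 3), fderiv ℝ χ x (curl (u τ) x) = 0) →
                      ∫ x, χ x * ⟪u τ x, curl (u τ) x⟫ = 0 := by
  intro ρ hρ hρ2 u p H c hcls T₁ M κ hdrift hκρ hpers τ hτ χ R hR hχ
  obtain ⟨hsw, hH, hgauge⟩ := hcls
  obtain ⟨hcl, hT₁, hM0, hκ1, _henv⟩ := hdrift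
  -- the helicity `h`; suppose it is non-zero
  set h : ℝ := ∫ x, χ x * ⟪u τ x, curl (u τ) x⟫ with hh
  by_contra hne
  have hh2 : 0 < h ^ 2 := by positivity
  -- gauges
  have hA : ∀ a : ℝ, 0 < a →
      ENNReal.ofReal (a ^ (2 * ρ)) * cknA a (0 : ℝ × EuclideanSpace ℝ (Fin 3)) u ≤ (c : ℝ≥0∞) :=
    fun a ha => (le_self_add.trans le_self_add).trans (hgauge a ha)
  have hE : ∀ a : ℝ, 0 < a →
      ENNReal.ofReal (a ^ ρ) * cknE a (0 : ℝ × EuclideanSpace ℝ (Fin 3)) H ≤ (c : ℝ≥0∞) :=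
    fun a ha => (le_add_self.trans le_self_add).trans (hgauge a ha)
  -- regularity of the slices
  have hC1 : ∀ t : ℝ, t < 0 → ContDiff ℝ 1 (u t) := fun t ht => (hcl.contDiff_velocity ht).of_le (by norm_cast)
  have hmeas : ∀ t : ℝ, t < 0 → Measurable (u t) := fun t ht => (hC1 t ht).continuous.measurable
  have hmeas_curl : ∀ t : ℝ, t < 0 → Measurable (curl (u t)) := fun t ht => (continuous_curl (hC1 t ht)).measurable
  have hτ0 : τ < 0 := lt_of_lt_of_le hτ hT₁
  -- exponents: `γ = min 2 (1-κ)⁻¹ > 2 - 3ρ`, `ε = γ - (2 - 3ρ) > 0`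
  have h1κ : 0 < 1 - κ := by linarith
  obtain ⟨γ, hγ⟩ : ∃ γ : ℝ, γ = min 2 (1 - κ)⁻¹ := ⟨_, rfl⟩
  have hγρ : 2 - 3 * ρ < γ := by rw [hγ]; exact exponent_race hκ1 hρ (by linarith) hκρ
  have hγ0 : 0 < γ := by rw [hγ]; exact lt_min two_pos (inv_pos.2 h1κ)
  have hε0 : 0 < γ - (2 - 3 * ρ) := by linarith
  -- constants
  set c' : ℝ := (c : ℝ) + 1 with hc'
  have hc'0 : 0 < c' := by rw [hc']; positivity
  have hcc' : (c : ℝ) ≤ c' := by rw [hc']; linarith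
  obtain ⟨c₁, hc₁⟩ : ∃ c₁ : ℝ, c₁ = (1 - κ) / (4 * (M + 1)) := ⟨_, rfl⟩
  have hc₁0 : 0 < c₁ := by rw [hc₁]; positivity
  obtain ⟨c₂, hc₂⟩ : ∃ c₂ : ℝ, c₂ = min 1 (c₁ ^ (1 - κ)⁻¹) := ⟨_, rfl⟩
  have hc₂0 : 0 < c₂ := by rw [hc₂]; exact lt_min one_pos (Real.rpow_pos_of_pos hc₁0 _)
  obtain ⟨K, hK⟩ : ∃ K : ℝ, K = 32 * c' ^ 2 / (c₂ * h ^ 2) := ⟨_, rfl⟩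
  have hK0 : 0 < K := by rw [hK]; positivity
  -- a large radius `a`: `a ≥ 1`, `a ≥ 2R`, `c₂ a^γ ≥ 2|τ|`, `a^ε > K`
  have hev1 : ∀ᶠ a : ℝ in atTop, 2 * (-τ) ≤ c₂ * a ^ γ :=
    ((tendsto_rpow_atTop hγ0).const_mul_atTop hc₂0).eventually_ge_atTop _
  have hev2 : ∀ᶠ a : ℝ in atTop, K < a ^ (γ - (2 - 3 * ρ)) :=
    (tendsto_rpow_atTop hε0).eventually_gt_atTop _
  obtain ⟨a, haA, hwinτ, hrace⟩ := ((eventually_ge_atTop (max 1 (2 * R))).and (hev1.and hev2)).exists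
  have ha1 : 1 ≤ a := le_trans (le_max_left _ _) haA
  have haR : 2 * R ≤ a := le_trans (le_max_right _ _) haA
  have ha0 : 0 < a := by linarith
  -- the usable window `(-L_a, τ)`
  obtain ⟨La, hLa⟩ : ∃ La : ℝ, La = min (a ^ 2) ((c₁ * a) ^ (1 - κ)⁻¹) := ⟨_, rfl⟩
  have hLa_sq : La ≤ a ^ 2 := by rw [hLa]; exact min_le_left _ _
  have hLa_c : La ≤ (c₁ * a) ^ (1 - κ)⁻¹ := by rw [hLa]; exact min_le_right _ _
  have hLa_ge : c₂ * a ^ γ ≤ La := by rw [hLa, hc₂, hγ]; exact window_le_rpow_min ha1 hc₁0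
  have hLa_τ : 2 * (-τ) ≤ La := hwinτ.trans hLa_ge
  -- the enstrophy floor on every slice of the window
  obtain ⟨Fa, hFa⟩ : ∃ Fa : ℝ, Fa = h ^ 2 / (c' * a ^ (1 - 2 * ρ)) := ⟨_, rfl⟩
  have haρ : 0 < a ^ (1 - 2 * ρ) := Real.rpow_pos_of_pos ha0 _
  have hFa0 : 0 < Fa := by rw [hFa]; positivity
  have hslice : ∀ s ∈ Ioo (-La) τ,
      ENNReal.ofReal Fa ≤ ∫⁻ x in ball (0 : EuclideanSpace ℝ (Fin 3)) a, ENNReal.ofReal (‖curl (u s) x‖ ^ 2) := by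
    intro s hs
    have hs0 : s < 0 := hs.2.trans hτ0
    obtain ⟨χ', ⟨_, hχ'1, hχ'0, _⟩, hχ'h⟩ := hpers τ hτ χ R hR hχ s hs.2
    -- the avatar's ball sits inside `B(0,a)`
    have hdrift : M / (1 - κ) * ((-s) ^ (1 - κ) - (-τ) ^ (1 - κ)) ≤ a / 4 :=
      drift_le_quarter hM0 h1κ hc₁ ha0 (by linarith) (by linarith) (by linarith [hs.1])
    have hRa : R + M / (1 - κ) * ((-s) ^ (1 - κ) - (-τ) ^ (1 - κ)) ≤ a := by linarith
    have hball : ball (0 : EuclideanSpace ℝ (Fin 3)) (R + M / (1 - κ) * ((-s) ^ (1 - κ) - (-τ) ^ (1 - κ))) ⊆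
        ball (0 : EuclideanSpace ℝ (Fin 3)) a := ball_subset_ball hRa
    -- Cauchy–Schwarz + the `A`-gauge
    have hcs := sq_integral_le_lintegral_mul_lintegral (hmeas s hs0) (hmeas_curl s hs0) hχ'1 hχ'0
    rw [hχ'h] at hcs
    have hsI : s ∈ Ioo (-(a ^ 2)) 0 := ⟨by linarith [hs.1], hs0⟩
    have hAs : ∫⁻ x in ball (0 : EuclideanSpace ℝ (Fin 3)) a, ‖u s x‖ₑ ^ 2 ≤ ENNReal.ofReal (c' * a ^ (1 - 2 * ρ)) :=
      (Backward.lintegral_ball_le_of_gaugeA ha0 (hA a ha0) hsI).trans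
        (ENNReal.ofReal_le_ofReal (mul_le_mul_of_nonneg_right hcc' haρ.le))
    have hkey : ENNReal.ofReal (h ^ 2) ≤ ENNReal.ofReal (c' * a ^ (1 - 2 * ρ)) *
        ∫⁻ x in ball (0 : EuclideanSpace ℝ (Fin 3)) a, ENNReal.ofReal (‖curl (u s) x‖ ^ 2) :=
      hcs.trans (mul_le_mul' ((lintegral_mono_set hball).trans hAs) (lintegral_mono_set hball))
    -- divide
    have hne0 : ENNReal.ofReal (c' * a ^ (1 - 2 * ρ)) ≠ 0 := by
      rw [ENNReal.ofReal_ne_zero_iff]; positivity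
    have hdiv : ENNReal.ofReal (h ^ 2) / ENNReal.ofReal (c' * a ^ (1 - 2 * ρ)) ≤
        ∫⁻ x in ball (0 : EuclideanSpace ℝ (Fin 3)) a, ENNReal.ofReal (‖curl (u s) x‖ ^ 2) := by
      rw [ENNReal.div_le_iff hne0 ENNReal.ofReal_ne_top, mul_comm]
      exact hkey
    have heq : ENNReal.ofReal Fa = ENNReal.ofReal (h ^ 2) / ENNReal.ofReal (c' * a ^ (1 - 2 * ρ)) := by
      rw [hFa, ENNReal.ofReal_div_of_pos (by positivity)]
    rw [heq]
    exact hdiv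
  -- integrate over the usable window and compare with the budget
  have hIoo : Ioo (-La) τ ⊆ Ioo (-a ^ 2) 0 := Ioo_subset_Ioo (by linarith) hτ0.le
  have hwin : ENNReal.ofReal (Fa * (τ - -La)) ≤ ENNReal.ofReal (16 * ((c : ℝ) * a ^ (1 - ρ))) := by
    calc ENNReal.ofReal (Fa * (τ - -La)) = ENNReal.ofReal Fa * ENNReal.ofReal (τ - -La) :=
          ENNReal.ofReal_mul hFa0.le
      _ = ∫⁻ _ in Ioo (-La) τ, ENNReal.ofReal Fa := by rw [setLIntegral_const, Real.volume_Ioo]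
      _ ≤ ∫⁻ s in Ioo (-La) τ, ∫⁻ x in ball (0 : EuclideanSpace ℝ (Fin 3)) a, ENNReal.ofReal (‖curl (u s) x‖ ^ 2) :=
          setLIntegral_mono' measurableSet_Ioo hslice
      _ ≤ ∫⁻ s in Ioo (-a ^ 2) 0, ∫⁻ x in ball (0 : EuclideanSpace ℝ (Fin 3)) a, ENNReal.ofReal (‖curl (u s) x‖ ^ 2) :=
          lintegral_mono_set hIoo
      _ ≤ ENNReal.ofReal (16 * ((c : ℝ) * a ^ (1 - ρ))) := lintegral_window_sq_curl_le hH hcl hE ha0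
  have hbudget : Fa * (τ + La) ≤ 16 * c' * a ^ (1 - ρ) := by
    have h1 := (ENNReal.ofReal_le_ofReal_iff (by positivity)).1 hwin
    have e : τ - -La = τ + La := by ring
    rw [e] at h1
    have h2 : 16 * ((c : ℝ) * a ^ (1 - ρ)) ≤ 16 * c' * a ^ (1 - ρ) := by
      have := Real.rpow_pos_of_pos ha0 (1 - ρ)
      nlinarith
    linarith
  -- the race, as arithmetic: `c₂ h² a^γ / 2 ≤ Fa (τ + L_a) c' a^{1-2ρ} ≤ 16 c'² a^{2-3ρ}`
  have hLa2 : La / 2 ≤ τ + La := by linarith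
  have h3 : h ^ 2 * (La / 2) ≤ 16 * c' ^ 2 * a ^ (2 - 3 * ρ) := by
    have e1 : h ^ 2 = Fa * (c' * a ^ (1 - 2 * ρ)) := by rw [hFa]; field_simp
    have e2 : a ^ (2 - 3 * ρ) = a ^ (1 - ρ) * a ^ (1 - 2 * ρ) := by
      rw [← Real.rpow_add ha0]; congr 1; ring
    calc h ^ 2 * (La / 2) = Fa * (La / 2) * (c' * a ^ (1 - 2 * ρ)) := by rw [e1]; ring
      _ ≤ Fa * (τ + La) * (c' * a ^ (1 - 2 * ρ)) :=
          mul_le_mul_of_nonneg_right (mul_le_mul_of_nonneg_left hLa2 hFa0.le) (by positivity)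
      _ ≤ 16 * c' * a ^ (1 - ρ) * (c' * a ^ (1 - 2 * ρ)) := mul_le_mul_of_nonneg_right hbudget (by positivity)
      _ = 16 * c' ^ 2 * a ^ (2 - 3 * ρ) := by rw [e2]; ring
  have h4 : c₂ * h ^ 2 * a ^ γ ≤ 32 * c' ^ 2 * a ^ (2 - 3 * ρ) := by
    have := mul_le_mul_of_nonneg_left hLa_ge hh2.le
    nlinarith
  -- `a^ε ≤ K`, contradiction
  have h5 : a ^ (γ - (2 - 3 * ρ)) ≤ K := by
    have ha23 : 0 < a ^ (2 - 3 * ρ) := Real.rpow_pos_of_pos ha0 _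
    have e : a ^ (γ - (2 - 3 * ρ)) = a ^ γ / a ^ (2 - 3 * ρ) := by
      rw [Real.rpow_sub ha0]
    rw [e, hK, div_le_div_iff₀ ha23 (by positivity)]
    have e3 : a ^ γ * (c₂ * h ^ 2) = c₂ * h ^ 2 * a ^ γ := by ring
    rw [e3]
    exact h4
  exact absurd h5 (not_le.2 hrace)

end Summit.NavierStokesRegularity.NavierStokesRegularity.Theorems.PowerGaugeEulerLiouville.HelicityTube

end
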